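import Mathlib.MeasureTheory.Measure.Haar.DistribChar
import Literature.NumberTheory.Automorphic.QuaternionAlgebraAdelicFujisaki
import Literature.NumberTheory.Automorphic.IwasawaDecompositionAdelic
import Literature.NumberTheory.Automorphic.GLnMaximalCompactCompact
import Literature.NumberTheory.Automorphic.UnipotentAdelicCompact
import Literature.NumberTheory.Automorphic.AdelicSecondCountable
import HarnessLib

/-!
# Left and right multiplication by `g ∈ GL_n(𝔸_K)` have the same module on `M_n(𝔸_K)`

For a number field `K` and `g ∈ GL_n(𝔸_K)`, the automorphisms `X ↦ g X` and `X ↦ X g` of the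
additive locally compact group `M_n(𝔸_K)` multiply Haar measure by the same factor
(`distribHaarChar_matrix_adele_eq_op`). Classically both factors are `|det g|ⁿ` (Weil, *Basic
Number Theory*, Ch. IV §3 Prop. 3 and Cor. 1, for the algebra `M_n(k)`, whose regular and coregular
norms both equal `detⁿ`). The proof given here avoids determinants: by the adelic Iwasawa
decomposition `GL_n(𝔸_K) = B(𝔸_K) · K_max` (`iwasawaDecomposition_gl_adelic_holds`) it suffices
to treat

* `k ∈ K_max = K_∞ GL_n(𝒪̂_K)`, a compact group (`isCompact_standardMaximalCompactGL`): both
  modules are `1`, since a homomorphism to `ℝ_{>0}` bounded on a subgroup is trivial there and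
  the module is continuous (`continuous_distribHaarChar`);
* unitriangular `u`: `N(𝔸_K) = N(K) · C` with `C` compact
  (`exists_isCompact_upperUnitriangular_adele`) and rational matrices map the lattice
  `M_n(K) ⊆ M_n(𝔸_K)` onto itself, hence have module `1`
  (`distribHaarChar_eq_one_of_smul_mem_iff`); so both modules are bounded on `N(𝔸_K)`, hence `1`;
* diagonal `t = diag(d)`: on the entries of `X`, resp. of its transpose, both `X ↦ t X` and
  `X ↦ X t` are multiplication by the unit `(dᵢ)_{i j}` of the product ring `𝔸_K^{n × n}`, so the
  two modules coincide (`distribHaarChar_eq_of_continuousAddEquiv`).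

Local compactness of `𝔸_K` and of `M_n(𝔸_K)` enter as instance hypotheses (both hold:
`locallyCompactSpace_adeleRing'` of `AdicCompletionCompact`).

## References

* A. Weil, *Basic Number Theory* (1967), Ch. I §2 (modules, Lemma 2), Ch. IV §2 Thm. 2, §3
  Prop. 3 and Cor. 1 [WeilBNT1967].
* J. R. Getz, H. Hahn, *An Introduction to Automorphic Representations* (2024), Thm. 2.7.1
  (Iwasawa decomposition) [GetzHahn2024].
-/

noncomputable section

open scoped NNReal ENNReal Pointwise MatrixGroups
open NumberField IsDedekindDomain MeasureTheory Measure Topology Filter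

namespace Literature.NumberTheory.Automorphic

/-! ### Generic lemmas on the module of an automorphism -/

section Generic

/-- A homomorphism to the positive reals which is bounded above on a subgroup is trivial on that
subgroup (its image is a bounded subgroup of `ℝ_{>0}`). [folklore] -/
theorem MonoidHom.apply_eq_one_of_bddAbove {G : Type*} [Group G] (f : G →* ℝ≥0)
    (hf : ∀ g, 0 < f g) (H : Subgroup G) (hb : BddAbove (f '' (H : Set G))) {g : G}
    (hg : g ∈ H) : f g = 1 := by
  obtain ⟨M, hM⟩ := hb
  have hpow : ∀ x ∈ H, ∀ k : ℕ, ¬ M < f x ^ k := fun x hx k =>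
    not_lt.2 (map_pow f x k ▸ hM ⟨x ^ k, H.pow_mem hx k, rfl⟩)
  rcases lt_trichotomy (f g) 1 with h | h | h
  · obtain ⟨k, hk⟩ := pow_unbounded_of_one_lt M ((one_lt_inv₀ (hf g)).2 h)
    exact absurd (by rwa [← map_inv] at hk) (hpow g⁻¹ (H.inv_mem hg) k)
  · exact h
  · obtain ⟨k, hk⟩ := pow_unbounded_of_one_lt M h
    exact absurd hk (hpow g hg k)

/-- For a locally compact topological ring `R`, the module of *right* multiplication `x ↦ x u`
by a unit `u` — `distribHaarChar R` of the opposite unit acting on `R` — depends continuously on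
`u ∈ Rˣ` (`continuous_distribHaarChar` composed with `u ↦ op u`). [folklore] -/
theorem continuous_distribHaarChar_op {R : Type*} [Ring R] [TopologicalSpace R]
    [IsTopologicalRing R] [LocallyCompactSpace R] [MeasurableSpace R] [BorelSpace R] :
    Continuous fun u : Rˣ => distribHaarChar R (Units.opEquiv.symm (MulOpposite.op u)) := by
  have h1 : Continuous fun u : Rˣ => Units.opEquiv.symm (MulOpposite.op u) := by
    refine Units.continuous_iff.2 ⟨?_, ?_⟩
    · simp only [Function.comp_def, Units.coe_opEquiv_symm, MulOpposite.unop_op]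
      exact MulOpposite.continuous_op.comp Units.continuous_val
    · have : ∀ u : Rˣ, (Units.opEquiv.symm (MulOpposite.op u))⁻¹ =
          Units.opEquiv.symm (MulOpposite.op u⁻¹) := by
        intro u
        rw [← map_inv, ← MulOpposite.op_inv]
      simp only [this, Units.coe_opEquiv_symm, MulOpposite.unop_op]
      exact MulOpposite.continuous_op.comp Units.continuous_coe_inv
  exact (continuous_distribHaarChar Rᵐᵒᵖˣ R).comp h1

end Generic

/-! ### Matrices over the adele ring -/

section Matrix

variable (n : ℕ) (K : Type) [Field K] [NumberField K]

/-- `M_n(K)` (matrices with principal-adele entries) is countable. [folklore] -/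
theorem countable_matrixLattice :
    Countable
      ((algebraMap K (AdeleRing (𝓞 K) K)).mapMatrix (m := Fin n)).toAddMonoidHom.range := by
  haveI : Countable K := countable_numberField K
  haveI : Countable (Matrix (Fin n) (Fin n) K) :=
    inferInstanceAs (Countable (Fin n → Fin n → K))
  exact (AddMonoidHom.rangeRestrict_surjective _).countable

/-- **`M_n(K)` is discrete in `M_n(𝔸_K)`** (entrywise: `K` is discrete in `𝔸_K`,
`AdeleRing.exists_isOpen_forall_algebraMap_mem_eq_zero`). [folklore] -/
theorem discreteTopology_matrixLattice :
    DiscreteTopology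
      ((algebraMap K (AdeleRing (𝓞 K) K)).mapMatrix (m := Fin n)).toAddMonoidHom.range := by
  haveI := compactSpace_adicCompletionIntegers' K
  obtain ⟨U, hU, hU0, hUK⟩ := AdeleRing.exists_isOpen_forall_algebraMap_mem_eq_zero K
  refine AddSubgroup.discreteTopology_of_isOpen_forall_eq_zero _
    (U := {x : Matrix (Fin n) (Fin n) (AdeleRing (𝓞 K) K) | ∀ i j, x i j ∈ U}) ?_
    (fun i j => by simpa using hU0) ?_
  · have : {x : Matrix (Fin n) (Fin n) (AdeleRing (𝓞 K) K) | ∀ i j, x i j ∈ U} =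
        ⋂ i, ⋂ j, (fun x : Matrix (Fin n) (Fin n) (AdeleRing (𝓞 K) K) => x i j) ⁻¹' U := by
      ext x
      simp only [Set.mem_setOf_eq, Set.mem_iInter, Set.mem_preimage]
    rw [this]
    exact isOpen_iInter_of_finite fun i => isOpen_iInter_of_finite fun j =>
      hU.preimage (continuous_id.matrix_elem i j)
  · rintro _ ⟨M, rfl⟩ hM
    have : M = 0 := Matrix.ext fun i j => hUK _ (hM i j)
    rw [this, map_zero]

/-- **`M_n(𝔸_K) ⧸ M_n(K)` is compact** (entrywise: `𝔸_K = K + C` with `C` compact,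
`AdeleRing.exists_isCompact_forall_exists_sub_mem`). [folklore] -/
theorem compactSpace_quotient_matrixLattice :
    CompactSpace (Matrix (Fin n) (Fin n) (AdeleRing (𝓞 K) K) ⧸
      ((algebraMap K (AdeleRing (𝓞 K) K)).mapMatrix (m := Fin n)).toAddMonoidHom.range) := by
  haveI := compactSpace_adicCompletionIntegers' K
  obtain ⟨C, hC, hcov⟩ := AdeleRing.exists_isCompact_forall_exists_sub_mem K
  have hC' :
      IsCompact {x : Matrix (Fin n) (Fin n) (AdeleRing (𝓞 K) K) | ∀ i j, x i j ∈ C} := by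
    have : {x : Matrix (Fin n) (Fin n) (AdeleRing (𝓞 K) K) | ∀ i j, x i j ∈ C} =
        Matrix.of '' (Set.univ.pi fun _ : Fin n => Set.univ.pi fun _ : Fin n => C) := by
      ext x
      simp only [Set.mem_setOf_eq, Set.mem_image, Set.mem_univ_pi]
      constructor
      · intro h
        exact ⟨fun i j => x i j, h, rfl⟩
      · rintro ⟨f, hf, rfl⟩
        exact hf
    rw [this]
    exact (isCompact_univ_pi fun _ => isCompact_univ_pi fun _ => hC).image
      (continuous_matrix fun i j => continuous_apply_apply i j)
  refine AddSubgroup.compactSpace_quotient_of_forall_exists_sub_mem _ hC' fun x => ?_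
  choose k hk using fun i j => hcov (x i j)
  refine ⟨(Matrix.of k).map (algebraMap K (AdeleRing (𝓞 K) K)), ⟨Matrix.of k, rfl⟩,
    fun i j => ?_⟩
  simpa using hk i j

/-- `GL_n(K)` maps the lattice `M_n(K) ⊆ M_n(𝔸_K)` into itself, by multiplication on either
side. [folklore] -/
theorem mul_mem_matrixLattice (γ : GL (Fin n) K) {x : Matrix (Fin n) (Fin n) (AdeleRing (𝓞 K) K)}
    (hx : x ∈ ((algebraMap K (AdeleRing (𝓞 K) K)).mapMatrix (m := Fin n)).toAddMonoidHom.range) :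
    (Matrix.GeneralLinearGroup.map (algebraMap K (AdeleRing (𝓞 K) K)) γ :
        Matrix (Fin n) (Fin n) (AdeleRing (𝓞 K) K)) * x ∈
        ((algebraMap K (AdeleRing (𝓞 K) K)).mapMatrix (m := Fin n)).toAddMonoidHom.range ∧
      x * (Matrix.GeneralLinearGroup.map (algebraMap K (AdeleRing (𝓞 K) K)) γ :
        Matrix (Fin n) (Fin n) (AdeleRing (𝓞 K) K)) ∈
        ((algebraMap K (AdeleRing (𝓞 K) K)).mapMatrix (m := Fin n)).toAddMonoidHom.range := by
  obtain ⟨M, rfl⟩ := hx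
  refine ⟨⟨(γ : Matrix (Fin n) (Fin n) K) * M, ?_⟩, ⟨M * (γ : Matrix (Fin n) (Fin n) K), ?_⟩⟩
  · change (algebraMap K (AdeleRing (𝓞 K) K)).mapMatrix ((γ : Matrix (Fin n) (Fin n) K) * M) = _
    rw [map_mul]; rfl
  · change (algebraMap K (AdeleRing (𝓞 K) K)).mapMatrix (M * (γ : Matrix (Fin n) (Fin n) K)) = _
    rw [map_mul]; rfl

/-- **`B = T N`**: an invertible upper triangular adelic matrix is `diag(d) · u` with `u`
unitriangular (its diagonal entries are units, as their product `det` is). [folklore] -/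
theorem exists_glDiagonal_mul_unitriangular {b : GL (Fin n) (AdeleRing (𝓞 K) K)}
    (hb : b ∈ standardParabolicGL (AdeleRing (𝓞 K) K) (id : Fin n → Fin n)) :
    ∃ (d : Fin n → (AdeleRing (𝓞 K) K)ˣ) (u : GL (Fin n) (AdeleRing (𝓞 K) K)),
      u ∈ upperUnitriangular (Fin n) (AdeleRing (𝓞 K) K) ∧ b = glDiagonal n _ d * u := by
  have hbT : (b : Matrix (Fin n) (Fin n) (AdeleRing (𝓞 K) K)).BlockTriangular id := hb
  have hdet : IsUnit (∏ i, (b : Matrix (Fin n) (Fin n) (AdeleRing (𝓞 K) K)) i i) := by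
    rw [← Matrix.det_of_upperTriangular hbT]
    exact (Matrix.isUnit_iff_isUnit_det _).1 (Units.isUnit b)
  have hunit : ∀ i, IsUnit ((b : Matrix (Fin n) (Fin n) (AdeleRing (𝓞 K) K)) i i) :=
    fun i => IsUnit.prod_iff.1 hdet i (Finset.mem_univ i)
  choose d hd using hunit
  refine ⟨d, (glDiagonal n _ d)⁻¹ * b, ?_, by rw [mul_inv_cancel_left]⟩
  rw [mem_upperUnitriangular_iff]
  have hcoe : (((glDiagonal n _ d)⁻¹ * b : GL (Fin n) (AdeleRing (𝓞 K) K)) :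
      Matrix (Fin n) (Fin n) (AdeleRing (𝓞 K) K)) =
      Matrix.diagonal (fun k => (((d k)⁻¹ : (AdeleRing (𝓞 K) K)ˣ) : AdeleRing (𝓞 K) K)) *
        (b : Matrix (Fin n) (Fin n) (AdeleRing (𝓞 K) K)) := by
    rw [Units.val_mul, ← map_inv, coe_glDiagonal]
    rfl
  refine ⟨?_, fun i => ?_⟩
  · rw [hcoe]
    exact (Matrix.blockTriangular_diagonal _).mul hbT
  · rw [hcoe, Matrix.diagonal_mul, ← hd i, Units.inv_mul]

variable [LocallyCompactSpace (Matrix (Fin n) (Fin n) (AdeleRing (𝓞 K) K))]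

/-- **Rational matrices have module `1`, left**: for `γ ∈ GL_n(K)`, `X ↦ γ X` preserves Haar
measure on `M_n(𝔸_K)`, since it maps the lattice `M_n(K)` onto itself
(`distribHaarChar_eq_one_of_smul_mem_iff`; Weil, BNT Ch. I §2 Lemma 2 with Ch. IV §2 Thm. 2).
[cite: WeilBNT1967, Ch. I §2 Lemma 2 and Ch. IV §2 Thm. 2] -/
theorem distribHaarChar_matrix_rational (γ : GL (Fin n) K) :
    distribHaarChar (Matrix (Fin n) (Fin n) (AdeleRing (𝓞 K) K))
      (Matrix.GeneralLinearGroup.map (algebraMap K (AdeleRing (𝓞 K) K)) γ) = 1 := by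
  borelize (Matrix (Fin n) (Fin n) (AdeleRing (𝓞 K) K))
  haveI : T2Space (AdeleRing (𝓞 K) K) := t2Space_adeleRing K
  haveI := countable_matrixLattice n K
  haveI := discreteTopology_matrixLattice n K
  haveI := compactSpace_quotient_matrixLattice n K
  refine distribHaarChar_eq_one_of_smul_mem_iff
    ((algebraMap K (AdeleRing (𝓞 K) K)).mapMatrix (m := Fin n)).toAddMonoidHom.range _
    fun x => ⟨fun h => ?_, fun h => (mul_mem_matrixLattice n K γ h).1⟩
  have := (mul_mem_matrixLattice n K γ⁻¹ h).1
  rwa [Units.smul_def, smul_eq_mul, ← mul_assoc, ← Units.val_mul, ← map_mul, inv_mul_cancel,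
    map_one, Units.val_one, one_mul] at this

/-- **Rational matrices have module `1`, right**: for `γ ∈ GL_n(K)`, `X ↦ X γ` preserves Haar
measure on `M_n(𝔸_K)` (it maps the lattice `M_n(K)` onto itself).
[cite: WeilBNT1967, Ch. I §2 Lemma 2 and Ch. IV §2 Thm. 2] -/
theorem distribHaarChar_matrix_rational_op (γ : GL (Fin n) K) :
    distribHaarChar (Matrix (Fin n) (Fin n) (AdeleRing (𝓞 K) K)) (Units.opEquiv.symm
      (MulOpposite.op (Matrix.GeneralLinearGroup.map (algebraMap K (AdeleRing (𝓞 K) K)) γ))) =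
      1 := by
  borelize (Matrix (Fin n) (Fin n) (AdeleRing (𝓞 K) K))
  haveI : T2Space (AdeleRing (𝓞 K) K) := t2Space_adeleRing K
  haveI := countable_matrixLattice n K
  haveI := discreteTopology_matrixLattice n K
  haveI := compactSpace_quotient_matrixLattice n K
  refine distribHaarChar_eq_one_of_smul_mem_iff
    ((algebraMap K (AdeleRing (𝓞 K) K)).mapMatrix (m := Fin n)).toAddMonoidHom.range _
    fun x => ⟨fun h => ?_, fun h => (mul_mem_matrixLattice n K γ h).2⟩
  have := (mul_mem_matrixLattice n K γ⁻¹ h).2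
  rwa [Units.smul_def, Units.coe_opEquiv_symm, MulOpposite.unop_op, op_smul_eq_mul, mul_assoc,
    ← Units.val_mul, ← map_mul, mul_inv_cancel, map_one, Units.val_one, mul_one] at this

/-- **Unitriangular matrices have module `1`, left.** `N(𝔸_K) = N(K) · C` with `C` compact
(`exists_isCompact_upperUnitriangular_adele`) and `N(K)` acts with module `1`, so the module — a
continuous homomorphism to `ℝ_{>0}` — is bounded on the subgroup `N(𝔸_K)`, hence trivial there.
[folklore] -/
theorem distribHaarChar_matrix_unitriangular {u : GL (Fin n) (AdeleRing (𝓞 K) K)}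
    (hu : u ∈ upperUnitriangular (Fin n) (AdeleRing (𝓞 K) K)) :
    distribHaarChar (Matrix (Fin n) (Fin n) (AdeleRing (𝓞 K) K)) u = 1 := by
  borelize (Matrix (Fin n) (Fin n) (AdeleRing (𝓞 K) K))
  obtain ⟨C, hC, -, hcov⟩ := exists_isCompact_upperUnitriangular_adele (K := K) n
  refine MonoidHom.apply_eq_one_of_bddAbove
    (distribHaarChar (Matrix (Fin n) (Fin n) (AdeleRing (𝓞 K) K)))
    (fun _ => distribHaarChar_pos) (upperUnitriangular (Fin n) (AdeleRing (𝓞 K) K)) ?_ hu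
  have hbdd : BddAbove
      ((fun g => distribHaarChar (Matrix (Fin n) (Fin n) (AdeleRing (𝓞 K) K)) g) '' C) :=
    (hC.image (continuous_distribHaarChar _ _)).bddAbove
  refine hbdd.mono ?_
  rintro _ ⟨v, hv, rfl⟩
  obtain ⟨γ, -, c, hc, rfl⟩ := hcov v hv
  refine ⟨c, hc, ?_⟩
  simp only [map_mul, distribHaarChar_matrix_rational, one_mul]

/-- **Unitriangular matrices have module `1`, right** (same argument for `X ↦ X u`).
[folklore] -/
theorem distribHaarChar_matrix_unitriangular_op {u : GL (Fin n) (AdeleRing (𝓞 K) K)}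
    (hu : u ∈ upperUnitriangular (Fin n) (AdeleRing (𝓞 K) K)) :
    distribHaarChar (Matrix (Fin n) (Fin n) (AdeleRing (𝓞 K) K))
      (Units.opEquiv.symm (MulOpposite.op u)) = 1 := by
  borelize (Matrix (Fin n) (Fin n) (AdeleRing (𝓞 K) K))
  obtain ⟨C, hC, -, hcov⟩ := exists_isCompact_upperUnitriangular_adele (K := K) n
  let ρ : GL (Fin n) (AdeleRing (𝓞 K) K) →* ℝ≥0 :=
    { toFun := fun g => distribHaarChar (Matrix (Fin n) (Fin n) (AdeleRing (𝓞 K) K))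
        (Units.opEquiv.symm (MulOpposite.op g))
      map_one' := by simp
      map_mul' := fun a b => by simp only [MulOpposite.op_mul, map_mul, mul_comm] }
  change ρ u = 1
  refine MonoidHom.apply_eq_one_of_bddAbove ρ (fun _ => distribHaarChar_pos)
    (upperUnitriangular (Fin n) (AdeleRing (𝓞 K) K)) ?_ hu
  have hbdd : BddAbove (ρ '' C) :=
    (hC.image (continuous_distribHaarChar_op
      (R := Matrix (Fin n) (Fin n) (AdeleRing (𝓞 K) K)))).bddAbove
  refine hbdd.mono ?_
  rintro _ ⟨v, hv, rfl⟩
  obtain ⟨γ, -, c, hc, rfl⟩ := hcov v hv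
  refine ⟨c, hc, ?_⟩
  rw [map_mul, show ρ (Matrix.GeneralLinearGroup.map _ γ) = 1 from
    distribHaarChar_matrix_rational_op n K γ, one_mul]

/-- **Elements of the maximal compact subgroup have module `1`, left**: the group
`K_max = K_∞ · GL_n(𝒪̂_K)` is compact (`isCompact_standardMaximalCompactGL`) and the module is a continuous homomorphism to
`ℝ_{>0}`. [folklore] -/
theorem distribHaarChar_matrix_maximalCompact {k : GL (Fin n) (AdeleRing (𝓞 K) K)}
    (hk : k ∈ standardMaximalCompactGL n K) :
    distribHaarChar (Matrix (Fin n) (Fin n) (AdeleRing (𝓞 K) K)) k = 1 := by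
  borelize (Matrix (Fin n) (Fin n) (AdeleRing (𝓞 K) K))
  refine MonoidHom.apply_eq_one_of_bddAbove
    (distribHaarChar (Matrix (Fin n) (Fin n) (AdeleRing (𝓞 K) K)))
    (fun _ => distribHaarChar_pos) (standardMaximalCompactGL n K) ?_ hk
  exact ((isCompact_standardMaximalCompactGL n K).image
    (continuous_distribHaarChar _ _)).bddAbove

/-- **Elements of the maximal compact subgroup have module `1`, right.** [folklore] -/
theorem distribHaarChar_matrix_maximalCompact_op {k : GL (Fin n) (AdeleRing (𝓞 K) K)}
    (hk : k ∈ standardMaximalCompactGL n K) :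
    distribHaarChar (Matrix (Fin n) (Fin n) (AdeleRing (𝓞 K) K))
      (Units.opEquiv.symm (MulOpposite.op k)) = 1 := by
  borelize (Matrix (Fin n) (Fin n) (AdeleRing (𝓞 K) K))
  let ρ : GL (Fin n) (AdeleRing (𝓞 K) K) →* ℝ≥0 :=
    { toFun := fun g => distribHaarChar (Matrix (Fin n) (Fin n) (AdeleRing (𝓞 K) K))
        (Units.opEquiv.symm (MulOpposite.op g))
      map_one' := by simp
      map_mul' := fun a b => by simp only [MulOpposite.op_mul, map_mul, mul_comm] }
  change ρ k = 1
  refine MonoidHom.apply_eq_one_of_bddAbove ρ (fun _ => distribHaarChar_pos)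
    (standardMaximalCompactGL n K) ?_ hk
  exact ((isCompact_standardMaximalCompactGL n K).image
    (continuous_distribHaarChar_op
      (R := Matrix (Fin n) (Fin n) (AdeleRing (𝓞 K) K)))).bddAbove

variable [LocallyCompactSpace (AdeleRing (𝓞 K) K)]

/-- **Diagonal matrices have the same left and right module.** Viewing `X ∈ M_n(𝔸_K)` as the
family of its entries, `X ↦ diag(d) X` is multiplication by the unit `(dᵢ)_{i j}` of the product
ring `𝔸_K^{n × n}`; viewing `X` through the entries of its transpose, so is `X ↦ X diag(d)`. Hence
both have the module of that unit acting on `𝔸_K^{n × n}`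
(`distribHaarChar_eq_of_continuousAddEquiv`). [folklore] -/
theorem distribHaarChar_matrix_diagonal_eq_op (d : Fin n → (AdeleRing (𝓞 K) K)ˣ) :
    distribHaarChar (Matrix (Fin n) (Fin n) (AdeleRing (𝓞 K) K)) (glDiagonal n _ d) =
      distribHaarChar (Matrix (Fin n) (Fin n) (AdeleRing (𝓞 K) K))
        (Units.opEquiv.symm (MulOpposite.op (glDiagonal n _ d))) := by
  -- the unit `(i, j) ↦ dᵢ` of the product ring
  obtain ⟨D, hD⟩ : ∃ D : (Fin n → Fin n → AdeleRing (𝓞 K) K)ˣ,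
      ∀ (f : Fin n → Fin n → AdeleRing (𝓞 K) K) (i j : Fin n),
        (D • f) i j = (d i : AdeleRing (𝓞 K) K) * f i j :=
    ⟨⟨fun i _ => (d i : AdeleRing (𝓞 K) K), fun i _ => ((d i)⁻¹ : (AdeleRing (𝓞 K) K)ˣ),
      funext fun i => funext fun _ => (d i).mul_inv,
      funext fun i => funext fun _ => (d i).inv_mul⟩, fun _ _ _ => rfl⟩
  -- entries: `X ↦ (X i j)_{i j}`
  obtain ⟨er, her⟩ : ∃ e : Matrix (Fin n) (Fin n) (AdeleRing (𝓞 K) K) ≃ₜ+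
      (Fin n → Fin n → AdeleRing (𝓞 K) K),
      ∀ (y : Matrix (Fin n) (Fin n) (AdeleRing (𝓞 K) K)) (i j : Fin n), e y i j = y i j :=
    ⟨{ toFun := fun x i j => x i j
       invFun := fun f => Matrix.of f
       left_inv := fun _ => rfl
       right_inv := fun _ => rfl
       map_add' := fun _ _ => rfl
       continuous_toFun := continuous_pi fun i => continuous_pi fun j =>
         continuous_id.matrix_elem i j
       continuous_invFun := continuous_matrix fun i j => continuous_apply_apply i j },
      fun _ _ _ => rfl⟩
  -- entries of the transpose: `X ↦ (X j i)_{i j}`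
  obtain ⟨ec, hec⟩ : ∃ e : Matrix (Fin n) (Fin n) (AdeleRing (𝓞 K) K) ≃ₜ+
      (Fin n → Fin n → AdeleRing (𝓞 K) K),
      ∀ (y : Matrix (Fin n) (Fin n) (AdeleRing (𝓞 K) K)) (i j : Fin n), e y i j = y j i :=
    ⟨{ toFun := fun x i j => x j i
       invFun := fun f => Matrix.of fun i j => f j i
       left_inv := fun _ => rfl
       right_inv := fun _ => rfl
       map_add' := fun _ _ => rfl
       continuous_toFun := continuous_pi fun i => continuous_pi fun j =>
         continuous_id.matrix_elem j i
       continuous_invFun := continuous_matrix fun i j => continuous_apply_apply j i },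
      fun _ _ _ => rfl⟩
  have h1 :
      distribHaarChar (Matrix (Fin n) (Fin n) (AdeleRing (𝓞 K) K)) (glDiagonal n _ d) =
        distribHaarChar (Fin n → Fin n → AdeleRing (𝓞 K) K) D := by
    refine distribHaarChar_eq_of_continuousAddEquiv er _ _ fun x => ?_
    funext i j
    rw [her, hD, her, Units.smul_def, smul_eq_mul, coe_glDiagonal, Matrix.diagonal_mul]
  have h2 : distribHaarChar (Matrix (Fin n) (Fin n) (AdeleRing (𝓞 K) K))
      (Units.opEquiv.symm (MulOpposite.op (glDiagonal n _ d))) =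
      distribHaarChar (Fin n → Fin n → AdeleRing (𝓞 K) K) D := by
    refine distribHaarChar_eq_of_continuousAddEquiv ec _ _ fun x => ?_
    funext i j
    rw [hec, hD, hec, Units.smul_def, Units.coe_opEquiv_symm, MulOpposite.unop_op,
      op_smul_eq_mul, coe_glDiagonal, Matrix.mul_diagonal, mul_comm]
  rw [h1, h2]

/-- **Left and right multiplication by `g ∈ GL_n(𝔸_K)` have the same module on `M_n(𝔸_K)`**:
`vol(g Z) = vol(Z g)` for additive Haar measure on `M_n(𝔸_K)` (both equal `|det g|ⁿ vol(Z)`: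
Weil, BNT Ch. IV §3 Prop. 3 and Cor. 1, the regular and coregular norms of `M_n(k)` both being
`detⁿ`). Proof by the Iwasawa decomposition `g = t u k` (`iwasawaDecomposition_gl_adelic_holds`,
`exists_glDiagonal_mul_unitriangular`) and the three previous computations.
[cite: WeilBNT1967, Ch. IV §3 Prop. 3 and Cor. 1] -/
theorem distribHaarChar_matrix_adele_eq_op (g : GL (Fin n) (AdeleRing (𝓞 K) K)) :
    distribHaarChar (Matrix (Fin n) (Fin n) (AdeleRing (𝓞 K) K)) g =
      distribHaarChar (Matrix (Fin n) (Fin n) (AdeleRing (𝓞 K) K))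
        (Units.opEquiv.symm (MulOpposite.op g)) := by
  have hIw : (standardParabolicGL (AdeleRing (𝓞 K) K) (id : Fin n → Fin n) :
      Set (GL (Fin n) (AdeleRing (𝓞 K) K))) *
      (standardMaximalCompactGL n K : Set (GL (Fin n) (AdeleRing (𝓞 K) K))) = Set.univ :=
    iwasawaDecomposition_gl_adelic_holds n K
  have hg : g ∈ (standardParabolicGL (AdeleRing (𝓞 K) K) (id : Fin n → Fin n) :
      Set (GL (Fin n) (AdeleRing (𝓞 K) K))) *
      (standardMaximalCompactGL n K : Set (GL (Fin n) (AdeleRing (𝓞 K) K))) := by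
    rw [hIw]; exact Set.mem_univ g
  obtain ⟨b, hb, k, hk, rfl⟩ := Set.mem_mul.1 hg
  obtain ⟨d, u, hu, rfl⟩ := exists_glDiagonal_mul_unitriangular n K hb
  rw [map_mul, map_mul, distribHaarChar_matrix_maximalCompact n K hk,
    distribHaarChar_matrix_unitriangular n K hu, distribHaarChar_matrix_diagonal_eq_op n K d]
  simp only [MulOpposite.op_mul, map_mul, distribHaarChar_matrix_maximalCompact_op n K hk,
    distribHaarChar_matrix_unitriangular_op n K hu, mul_one, one_mul]

end Matrix

end Literature.NumberTheory.Automorphic
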